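import Summits.QuantumFields.BalabanUV.Beta.EriceRemainderEnclosureHistoryAutonomyComparisonTwoAgesLemmas

/-!
# EriceRemainderEnclosureHistoryAutonomyComparisonTowerLemmas — (E62a) LEMMAS FOR HYPER-SEPARATED TOWERS OF ANY HEIGHT: for `B(u) = b + Σ_{k<K} L_k·u_k`
# with `L ≥ 0` supported on a finite set `A` of ages `≥ 1`, along box solutions `h′ ≤ h` of `B′ ≥ B`, `B` from one pin — the ACCELERATION `√2` AT EVERY
# SCALE (`L_k·j·h_j³ ≤ √2` for `j ≥ k`), the uniform DROP BOUND (every profile term drops by at most `(√2∕2)·η` at every scale, `η` the slope of the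
# level-gap sandwich), the OLD DROP OVER A YOUNG WINDOW (`≥ (1 − 2t)·D_{k′} − (√2∕2)·t·D̄`), the BUDGET RECURSION over the ages
# (`D_k ≤ c·η₊ − c(1−2t)·Σ_{k′>k} D_{k′}` for all `k ∈ A` ⟹ `(1−2t)·Σ_{k∈A} D_k ≤ η₊·(1 − (1 − c(1−2t))^{#A})` — the ZONE PRODUCT LAW: the budget left to
# the younger ages shrinks by the factor `1 − c(1−2t)` per age) and the numerical assembly (`(#A² + 4)·t ≤ 2·(1 − √2∕2)^{#A}` suffices); the sequel
# (E62b) `…ComparisonTower` assembles THE STEP and the comparison theorem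

Cell `pub-balaban`, β-function sub-cell, BINDER row D4 «RemainderConst leaves for Bałaban's split» (`HOME/BINDER-OWNERS.md`; owner lineage `b2b-balaban-beta-an4`;
this file by co-owner #2 lineage `b2b-balaban-beta-d4-p2`, generation 55), β-FLOW TEAM duty (1), FREEZE (0) honoured (def-free; (E59c)'s
`mul_term_read_le_invSq` ∕ `old_gap_window`, (E58b)'s `mul_invSq_add_le`, (E41)'s `affine_monotone` ∕ `affine_floor`, (E48a)'s `strictAnti_of_memFlow`, node U2's
`SeqBox` ∕ `MemFlow` ∕ `Sharpness.abs_sub_le_half_cube_mul` BY NAME; nothing restated).  Sequel of (E59c)∕(E59d) `…ComparisonTwoAgesLemmas` ∕ `…TwoAgesFar`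
(two ages far apart: peeling the young age) — here the peeling is run through ANY number of hyper-separated ages.

HONEST FRAMING (page 1, verbatim and binding).  *"Discharging BetaPertH makes Bałaban's UV stability UNCONDITIONAL — a real constructive-QFT result; it is
NOT the continuum limit and NOT the Clay problem."*  THIS FILE DISCHARGES NOTHING OF THE KIND.  Elementary real analysis about ABSTRACT affine functionals on
a box ]0,γ]^ℕ with displayed supports and signs — hypotheses of a census, not facts; the form, signs, ages and moments of Bałaban's (1.22) limit functional
are NOT PRINTED ([I] p. 298; GAPS G-t4-U2-1∕-2) and NOT asserted.  Row D4 class UNCHANGED (critical-path width 0; instance 0∕1; D4 DISCHARGE NO DATE).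
HONEST DEPENDENCY: continuum YM on T⁴ ⇐ BetaPertH ∧ nine spine estimates (0/9 proved); BetaPertH ⇐ (D1) ∧ (D4) ∧ CAP+tail; G-an2-4 gates asym, D1 and
NE2/3/4.

THE POINT (census sense (α); the COMPARISON column of the autonomy row).  By (E58a) comparison at any size is THE STEP: along box solutions `h′ ≤ h` from
one pin the drop `d₀ = B h − B h′ = Σ_{k∈A} D_k`, `D_k = L_k·(h_k − h′_k)`, is at most the excess `η`.  Every BARRIER ∕ CERTIFICATE method of the column
((E58b) level weight, (E60b) certificates, (E61a)∕(E61d) accelerated flow) pays each deeper step of the perturbed trajectory at the full rate `η` and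
stops at kernel mass `T ≤ 1` (`HOME/b2b-balaban-beta-d4-p2/g54/e61/README.md`); towers of `n ≥ 3` hyper-separated unit blocks have `T > 1`.  (E59d)
went beyond bookkeeping for TWO ages by PEELING: the young drop is paid by its own acceleration `c = √2∕2` out of a budget that the OLD drops over
the young window have ALREADY REDUCED.  This file runs the peeling through `n` ages `k_0 < k_1 < … < k_{n−1}` with `k_i ≤ t·k_j` (`i < j`):
(1) `D_k ≤ (c∕k)·δ_k` (acceleration, `L_k·k·h_k³ ≤ √2`) and `δ_k ≤ k·η − Σ_{l≤k} d_l` (increment identity); (2) over the window `l ≤ k` of age `k` EVERY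
older age `k′ > k` drops by at least `(1 − 2t)·D_{k′} − c·t·D̄` (§2 `old_drop_window`: (E59c)'s `old_gap_window` — gap scaling at fixed level gap and
concavity — with the level gap at `k′ + l` reduced by at most the intermediate drops, each `≤ D̄ = n·c·η` by §1 `drop_le`: EVERY profile term drops
by at most `c·η` at EVERY scale, `term_drop_le`, from the acceleration AT EVERY SCALE `L_k·j·h_j³ ≤ √2`, `j ≥ k`, `accel_sqrt_two_at`); hence
(3) **`D_k ≤ c·η₊ − c·(1 − 2t)·Σ_{k′∈A, k′>k} D_{k′}`**, `η₊ = η·(1 + n²t∕2)`: a TRIANGULAR system over the ages.  §3 `budget`: such a system forces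
**`(1 − 2t)·Σ_{k∈A} D_k ≤ η₊·(1 − θ^n)`**, `θ = 1 − c(1 − 2t)` — by induction on the youngest age (`Finset.induction_on_min`): with `S` the older total,
`D_young + S ≤ c·η₊ + θ·S`; in words, THE BUDGET LEFT TO THE YOUNGER AGES SHRINKS BY THE FACTOR `θ` PER AGE — the ZONE PRODUCT LAW of `g54/e61/README.md`
(«`Ψ_i = Ψ_{i+1}∕(1+C_i)`») in rigorous, crude-constant form (`θ → 1 − √2∕2 ≈ 0.293` as `t → 0`; the measured per-zone factor is `≈ 0.56`,
`HOME/…/g55/e62/README.md`).  §4 `assembly_le`: `η₊·(1 − θ^n) ≤ η·(1 − 2t)` as soon as **`(n² + 4)·t ≤ 2·(1 − √2∕2)^n`**.  NOT CLAIMED: anything for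
ratios below that threshold with `n ≥ 3` (conjecture (E58′) stays OPEN there), Markov terms or dense blocks riding along, necessity, anything printed.

WHAT IS PROVED ([folklore]; 0 `def`, 0 sorry).  §1 `sum_support`, **`accel_sqrt_two_at`**, **`term_drop_le`**, `drop_le`.  §2 **`old_drop_window`**,
`window_sum_ge`.  §3 **`budget`**.  §4 `one_sub_sqrt_two_div_two_bounds`, `t_lt_half`, **`assembly_le`**.
-/
noncomputable section
open Finset Set

namespace Summit.QuantumFields.BalabanUV.Beta.EriceRemainderEnclosureHistoryAutonomyComparisonTowerLemmas

open Literature.MathematicalPhysics.QuantumFieldTheory.Balaban1983to89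
open Literature.MathematicalPhysics.QuantumFieldTheory.Balaban1983to89.T4BetaStationary
open Literature.MathematicalPhysics.QuantumFieldTheory.Balaban1983to89.T4BetaFlowWellPosed
open Literature.MathematicalPhysics.QuantumFieldTheory.Balaban1983to89.T4BetaFlowWellPosed.Sharpness (abs_sub_le_half_cube_mul)
open Summit.QuantumFields.BalabanUV.Beta.EriceRemainderEnclosureHistoryAutonomyOrder (strictAnti_of_memFlow)
open Summit.QuantumFields.BalabanUV.Beta.EriceRemainderEnclosureHistoryAutonomyComparisonAffineProfile (mul_invSq_add_le)
open Summit.QuantumFields.BalabanUV.Beta.EriceRemainderEnclosureHistoryAutonomyMonotone (affine_monotone affine_floor)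
open Summit.QuantumFields.BalabanUV.Beta.EriceRemainderEnclosureHistoryAutonomyComparisonTwoAgesLemmas

variable {γ b y : ℝ} {L : ℕ → ℝ} {K : ℕ} {h h' : ℕ → ℝ} {A : Finset ℕ}

/-! ## §1 Sums over the support; the acceleration `√2` at every scale; every term drops by at most `(√2∕2)·η` -/

/-- A profile supported on `A ⊆ range K` sums over `A`. [folklore] -/
theorem sum_support (hAK : A ⊆ range K) (hsupp : ∀ k ∈ range K, k ∉ A → L k = 0) (f : ℕ → ℝ) :
    ∑ k ∈ range K, L k * f k = ∑ k ∈ A, L k * f k :=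
  (sum_subset hAK fun k hk hkA => by rw [hsupp k hk hkA, zero_mul]).symm

/-- **ACCELERATION `√2` AT EVERY SCALE**: along a box solution of `B = b + Σ_{k<K} L_k·u_k` (`L ≥ 0`, `b > 0`) from any pin, for every profile age
`k < K` and every scale `j ≥ k`, `j ≥ 1`: `L_k·j·h_j³ ≤ √2` — the `j` increments before scale `j` each read at age `k` a coupling `≥ h(j+k) ≥ h(2j)`
((E59c) `mul_term_read_le_invSq`) and `h_j ≤ √2·h_{2j}` (concavity, (E58b) `mul_invSq_add_le`); (E59c) `accel_sqrt_two` is the case `j = k`. [folklore] -/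
theorem accel_sqrt_two_at (hL : ∀ k, 0 ≤ L k) (hb : 0 < b) (hy : 0 < y) (hh : SeqBox γ h)
    (hf : MemFlow (fun u : ℕ → ℝ => b + ∑ k ∈ range K, L k * u k) y h) {k : ℕ} (hk : k ∈ range K) {j : ℕ} (hkj : k ≤ j) (hj1 : 1 ≤ j) :
    L k * j * h j ^ 3 ≤ Real.sqrt 2 := by
  have hanti := (strictAnti_of_memFlow hb (affine_floor hL) hh hf).antitone
  have h1 := mul_term_read_le_invSq hL hb hy hh hf hk j
  have hc := mul_invSq_add_le (affine_monotone hL) hb (affine_floor hL) hy hh hf j j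
  have hjpos : (0 : ℝ) < j := by exact_mod_cast hj1
  have hj0 := (hh j).1
  have h2j := (hh (j + j)).1
  -- 1/h(2j)² ≤ 2/h(j)²
  have h2 : 1 / h (j + j) ^ 2 ≤ 2 * (1 / h j ^ 2) := by
    have : (j : ℝ) * (1 / h (j + j) ^ 2) ≤ (j : ℝ) * (2 * (1 / h j ^ 2)) := by
      rw [show ((j : ℝ) + j) = (j : ℝ) * 2 by ring] at hc; linarith
    exact le_of_mul_le_mul_left this hjpos
  -- h j ≤ √2 · h(2j)
  have h3 : h j ≤ Real.sqrt 2 * h (j + j) := by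
    have e : h j ^ 2 ≤ 2 * h (j + j) ^ 2 := by
      rw [div_le_iff₀ (by positivity)] at h2
      have : 2 * (1 / h j ^ 2) * h (j + j) ^ 2 = 2 * h (j + j) ^ 2 / h j ^ 2 := by ring
      rw [this, le_div_iff₀ (by positivity)] at h2
      linarith
    have := Real.sqrt_le_sqrt e
    rwa [Real.sqrt_sq hj0.le, Real.sqrt_mul (by norm_num), Real.sqrt_sq h2j.le] at this
  -- the read at age k from scale j is at least h(2j)
  have h4 : (j : ℝ) * (L k * h (j + j)) * h j ^ 2 ≤ 1 := by
    have hread : (j : ℝ) * (L k * h (j + j)) ≤ (j : ℝ) * (L k * h (j + k)) :=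
      mul_le_mul_of_nonneg_left (mul_le_mul_of_nonneg_left (hanti (by omega)) (hL k)) hjpos.le
    have := mul_le_mul_of_nonneg_right (hread.trans h1) (sq_nonneg (h j))
    rwa [one_div_mul_cancel (by positivity)] at this
  have h5 : 0 ≤ (j : ℝ) * (L k * h j ^ 2) := by have := hL k; positivity
  calc L k * j * h j ^ 3 = (j : ℝ) * (L k * h j ^ 2) * h j := by ring
    _ ≤ (j : ℝ) * (L k * h j ^ 2) * (Real.sqrt 2 * h (j + j)) := mul_le_mul_of_nonneg_left h3 h5
    _ = Real.sqrt 2 * ((j : ℝ) * (L k * h (j + j)) * h j ^ 2) := by ring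
    _ ≤ Real.sqrt 2 * 1 := mul_le_mul_of_nonneg_left h4 (Real.sqrt_nonneg _)
    _ = Real.sqrt 2 := mul_one _

/-- **EVERY PROFILE TERM DROPS BY AT MOST `(√2∕2)·η` AT EVERY SCALE**: `h′ ≤ h` box histories, `h` a box solution of `B = b + Σ_{k<K} L_k·u_k` from a pin,
the level gaps sandwiched by `1∕h′_n² − 1∕h_n² ≤ n·η`; then for every profile age `1 ≤ k < K` and every scale `m`:
`L_k·(h(m+k) − h′(m+k)) ≤ (√2∕2)·η` (coupling gap `≤ (h³∕2)`·level gap, and `accel_sqrt_two_at` at scale `m + k`). [folklore] -/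
theorem term_drop_le {η : ℝ} (hL : ∀ k, 0 ≤ L k) (hb : 0 < b) (hy : 0 < y) (hh : SeqBox γ h)
    (hf : MemFlow (fun u : ℕ → ℝ => b + ∑ k ∈ range K, L k * u k) y h) (hh' : SeqBox γ h') (hle : ∀ j, h' j ≤ h j) (hη : 0 ≤ η)
    (hδle : ∀ n : ℕ, 1 / h' n ^ 2 - 1 / h n ^ 2 ≤ (n : ℝ) * η) {k : ℕ} (hk : k ∈ range K) (hk1 : 1 ≤ k) (m : ℕ) :
    L k * (h (m + k) - h' (m + k)) ≤ Real.sqrt 2 / 2 * η := by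
  have hj1 : 1 ≤ m + k := le_add_left hk1
  have hm := (hh (m + k)).1
  have hm' := (hh' (m + k)).1
  have hg0 : 0 ≤ h (m + k) - h' (m + k) := by linarith [hle (m + k)]
  have hδ0 : 0 ≤ 1 / h' (m + k) ^ 2 - 1 / h (m + k) ^ 2 :=
    sub_nonneg.mpr (one_div_le_one_div_of_le (pow_pos hm' 2) (pow_le_pow_left₀ hm'.le (hle _) 2))
  have hg : h (m + k) - h' (m + k) ≤ h (m + k) ^ 3 / 2 * (1 / h' (m + k) ^ 2 - 1 / h (m + k) ^ 2) := by
    have hw := abs_sub_le_half_cube_mul hm hm' le_rfl (hle (m + k))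
    rwa [abs_of_nonneg hg0, abs_sub_comm, abs_of_nonneg hδ0] at hw
  have hacc := accel_sqrt_two_at hL hb hy hh hf hk (Nat.le_add_left k m) hj1
  have hpos : 0 ≤ h (m + k) ^ 3 / 2 := by positivity
  calc L k * (h (m + k) - h' (m + k)) ≤ L k * (h (m + k) ^ 3 / 2 * ((((m + k : ℕ) : ℝ)) * η)) :=
        mul_le_mul_of_nonneg_left (hg.trans (mul_le_mul_of_nonneg_left (hδle (m + k)) hpos)) (hL k)
    _ = L k * ((m + k : ℕ) : ℝ) * h (m + k) ^ 3 * (η / 2) := by ring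
    _ ≤ Real.sqrt 2 * (η / 2) := mul_le_mul_of_nonneg_right hacc (by positivity)
    _ = Real.sqrt 2 / 2 * η := by ring

/-- THE DROP READ AT ANY SCALE IS AT MOST `#A·(√2∕2)·η` for a profile supported on ages `A ⊆ [1, K[`. [folklore] -/
theorem drop_le {η : ℝ} (hL : ∀ k, 0 ≤ L k) (hb : 0 < b) (hy : 0 < y) (hh : SeqBox γ h)
    (hf : MemFlow (fun u : ℕ → ℝ => b + ∑ k ∈ range K, L k * u k) y h) (hh' : SeqBox γ h') (hle : ∀ j, h' j ≤ h j) (hη : 0 ≤ η)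
    (hδle : ∀ n : ℕ, 1 / h' n ^ 2 - 1 / h n ^ 2 ≤ (n : ℝ) * η) (hAK : A ⊆ range K) (hA1 : ∀ k ∈ A, 1 ≤ k) (m : ℕ) :
    ∑ k ∈ A, L k * (h (m + k) - h' (m + k)) ≤ (A.card : ℝ) * (Real.sqrt 2 / 2 * η) := by
  calc ∑ k ∈ A, L k * (h (m + k) - h' (m + k)) ≤ ∑ _k ∈ A, Real.sqrt 2 / 2 * η :=
        sum_le_sum fun k hk => term_drop_le hL hb hy hh hf hh' hle hη hδle (hAK hk) (hA1 k hk) m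
    _ = (A.card : ℝ) * (Real.sqrt 2 / 2 * η) := by rw [sum_const, nsmul_eq_mul]

/-! ## §2 The old drop over a young window -/

/-- **THE OLD DROP OVER A YOUNG WINDOW.**  Ages `k′ ≥ 1` (old) and a window scale `l + 1` with `l + 1 ≤ t·k′`; `D̄ ≥ 0` bounds every drop read beyond
`k′` (so the level gap at `k′ + l + 1` is at least the level gap at `k′` minus `(l+1)·D̄`); `L_{k′}·h_{k′}³∕2 ≤ c∕k′` with `c = √2∕2`.  Then the old term's
drop at scale `l + 1` is at least `(1 − 2t)·D_{k′} − c·t·D̄`, `D_{k′} = L_{k′}·(h_{k′} − h′_{k′})` ((E59c) `old_gap_window`, coefficients weakened). [folklore] -/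
theorem old_drop_window {t Dbar : ℝ} (hL : ∀ k, 0 ≤ L k) (hb : 0 < b) (hy : 0 < y) (hh : SeqBox γ h)
    (hf : MemFlow (fun u : ℕ → ℝ => b + ∑ k ∈ range K, L k * u k) y h) (hh' : SeqBox γ h') (hle : ∀ j, h' j ≤ h j)
    {k' : ℕ} (hk'K : k' ∈ range K) (hk'1 : 1 ≤ k') (l : ℕ) (hlt : ((l + 1 : ℕ) : ℝ) ≤ t * k') (hDbar : 0 ≤ Dbar)
    (hlev : (1 / h' k' ^ 2 - 1 / h k' ^ 2) - ((l + 1 : ℕ) : ℝ) * Dbar ≤ 1 / h' (k' + (l + 1)) ^ 2 - 1 / h (k' + (l + 1)) ^ 2) :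
    (1 - 2 * t) * (L k' * (h k' - h' k')) - Real.sqrt 2 / 2 * t * Dbar ≤ L k' * (h (k' + (l + 1)) - h' (k' + (l + 1))) := by
  have hk'r : (0 : ℝ) < k' := by exact_mod_cast hk'1
  have hX0 : 0 ≤ L k' * (h k' - h' k') := mul_nonneg (hL k') (by linarith [hle k'])
  have hwin := old_gap_window hL hb hy hh hf hh' hle hk'1 (l + 1) (E := ((l + 1 : ℕ) : ℝ) * Dbar) (by positivity) hlev
  have h1 := mul_le_mul_of_nonneg_left hwin (hL k')
  -- the acceleration at the old age: L k′ · h k′³/2 ≤ c/k′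
  have hacc : L k' * (h k' ^ 3 / 2) ≤ Real.sqrt 2 / 2 / k' := by
    rw [le_div_iff₀ hk'r]
    have := accel_sqrt_two_at hL hb hy hh hf hk'K le_rfl hk'1
    linarith
  have hratio : (((l + 1 : ℕ) : ℝ)) / k' ≤ t := by rw [div_le_iff₀ hk'r]; exact hlt
  have i1 : ((((l + 1 : ℕ) : ℝ)) / k') * (L k' * (h k' - h' k')) ≤ t * (L k' * (h k' - h' k')) :=
    mul_le_mul_of_nonneg_right hratio hX0
  have i2 : L k' * (h k' ^ 3 / 2) * ((((l + 1 : ℕ) : ℝ)) * Dbar) ≤ Real.sqrt 2 / 2 * t * Dbar := by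
    calc L k' * (h k' ^ 3 / 2) * ((((l + 1 : ℕ) : ℝ)) * Dbar) ≤ Real.sqrt 2 / 2 / k' * ((((l + 1 : ℕ) : ℝ)) * Dbar) :=
          mul_le_mul_of_nonneg_right hacc (by positivity)
      _ = Real.sqrt 2 / 2 * (((((l + 1 : ℕ) : ℝ)) / k') * Dbar) := by field_simp
      _ ≤ Real.sqrt 2 / 2 * (t * Dbar) := mul_le_mul_of_nonneg_left (mul_le_mul_of_nonneg_right hratio hDbar) (by positivity)
      _ = Real.sqrt 2 / 2 * t * Dbar := by ring
  have e : L k' * ((1 - 2 * ((((l + 1 : ℕ) : ℝ)) / k')) * (h k' - h' k') - h k' ^ 3 / 2 * ((((l + 1 : ℕ) : ℝ)) * Dbar))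
      = L k' * (h k' - h' k') - 2 * (((((l + 1 : ℕ) : ℝ)) / k') * (L k' * (h k' - h' k')))
        - L k' * (h k' ^ 3 / 2) * ((((l + 1 : ℕ) : ℝ)) * Dbar) := by ring
  rw [e] at h1
  linarith

/-- THE YOUNG WINDOW SUM: if over each of the `k` window scales `l + 1 ≤ k` the total drop is at least `W`, then `Σ_{l<k} d_{l+1} ≥ k·W`. [folklore] -/
theorem window_sum_ge {dd : ℕ → ℝ} {W : ℝ} {k : ℕ} (hW : ∀ l ∈ range k, W ≤ dd (l + 1)) : (k : ℝ) * W ≤ ∑ l ∈ range k, dd (l + 1) := by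
  calc (k : ℝ) * W = ∑ _l ∈ range k, W := by rw [sum_const, card_range, nsmul_eq_mul]
    _ ≤ ∑ l ∈ range k, dd (l + 1) := sum_le_sum hW

/-! ## §3 The budget recursion over the ages: the zone product law -/

/-- **THE BUDGET RECURSION (ZONE PRODUCT LAW).**  Nonnegative `D_k`, `k ∈ A` (a finite set of ages), with the TRIANGULAR system
`D_k ≤ c·η₊ − c·(1 − 2t)·Σ_{k′∈A, k′>k} D_{k′}` for every `k ∈ A`, where `0 ≤ 1 − 2t` and `0 ≤ θ := 1 − c·(1 − 2t)`.  Then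
`(1 − 2t)·Σ_{k∈A} D_k ≤ η₊·(1 − θ^{#A})` — induction on the youngest age: the older ages solve the same system, and with `S` their total the youngest adds
`D ≤ c·η₊ − c(1−2t)·S`, so the total is `≤ c·η₊ + θ·S`: the budget left over shrinks by the factor `θ` per age. [folklore] -/
theorem budget {D : ℕ → ℝ} {c t ηp : ℝ} (h2t : 0 ≤ 1 - 2 * t) (hθ : 0 ≤ 1 - c * (1 - 2 * t)) (A : Finset ℕ)
    (hD0 : ∀ k ∈ A, 0 ≤ D k) (hrec : ∀ k ∈ A, D k ≤ c * ηp - c * (1 - 2 * t) * ∑ k' ∈ A.filter (fun k' => k < k'), D k') :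
    (1 - 2 * t) * ∑ k ∈ A, D k ≤ ηp * (1 - (1 - c * (1 - 2 * t)) ^ A.card) := by
  induction A using Finset.induction_on_min with
  | empty => simp
  | insert a s has ih =>
    have hnot : a ∉ s := fun ha => lt_irrefl a (has a ha)
    -- the older ages solve the same system
    have hfilt : ∀ k ∈ s, (insert a s).filter (fun k' => k < k') = s.filter (fun k' => k < k') := by
      intro k hk
      ext k'
      simp only [mem_filter, Finset.mem_insert]
      constructor
      · rintro ⟨hk' | hk', hkk'⟩
        · exact absurd (hk'.symm ▸ hkk' : k < a) (not_lt.mpr (has k hk).le)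
        · exact ⟨hk', hkk'⟩
      · rintro ⟨hk', hkk'⟩; exact ⟨Or.inr hk', hkk'⟩
    have hS := ih (fun k hk => hD0 k (mem_insert_of_mem hk)) (fun k hk => by rw [← hfilt k hk]; exact hrec k (mem_insert_of_mem hk))
    -- the youngest age sees the total of the older ones
    have hfa : (insert a s).filter (fun k' => a < k') = s := by
      ext k'
      simp only [mem_filter, Finset.mem_insert]
      constructor
      · rintro ⟨hk' | hk', hak'⟩
        · exact absurd (hk' ▸ hak' : a < a) (lt_irrefl a)
        · exact hk'
      · intro hk'; exact ⟨Or.inr hk', has k' hk'⟩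
    have ha := hrec a (mem_insert_self a s)
    rw [hfa] at ha
    set S : ℝ := ∑ k ∈ s, D k with hS_def
    set θ : ℝ := 1 - c * (1 - 2 * t) with hθ_def
    have hS0 : 0 ≤ S := sum_nonneg fun k hk => hD0 k (mem_insert_of_mem hk)
    rw [sum_insert hnot, card_insert_of_notMem hnot, pow_succ]
    -- (1−2t)(D a + S) ≤ (1−2t)(c η₊ + θ S) = (1−θ) η₊ + θ (1−2t) S ≤ (1−θ) η₊ + θ η₊ (1 − θ^m)
    have h1 : (1 - 2 * t) * (D a + S) ≤ (1 - 2 * t) * (c * ηp - c * (1 - 2 * t) * S + S) :=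
      mul_le_mul_of_nonneg_left (by linarith) h2t
    have h2 : θ * ((1 - 2 * t) * S) ≤ θ * (ηp * (1 - θ ^ s.card)) := mul_le_mul_of_nonneg_left hS hθ
    have e1 : (1 - 2 * t) * (c * ηp - c * (1 - 2 * t) * S + S) = (1 - θ) * ηp + θ * ((1 - 2 * t) * S) := by
      simp only [hθ_def]; ring
    have e2 : (1 - θ) * ηp + θ * (ηp * (1 - θ ^ s.card)) = ηp * (1 - θ ^ s.card * θ) := by ring
    linarith

/-! ## §4 The numerical assembly -/

/-- `0.2928 < 1 − √2∕2 ≤ 3∕10`. [folklore] -/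
theorem one_sub_sqrt_two_div_two_bounds : 0.2928 < 1 - Real.sqrt 2 / 2 ∧ 1 - Real.sqrt 2 / 2 ≤ 3 / 10 := by
  have hhi := sqrt_two_lt
  have hlo : 1.4 ≤ Real.sqrt 2 := by
    rw [show (1.4 : ℝ) = Real.sqrt (1.4 ^ 2) by rw [Real.sqrt_sq (by norm_num)]]
    exact Real.sqrt_le_sqrt (by norm_num)
  constructor <;> linarith

/-- Under the separation condition `(n² + 4)·t ≤ 2·(1 − √2∕2)^n` with `n ≥ 1`: `t < 1∕2` (indeed `t ≤ 0.12`). [folklore] -/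
theorem t_lt_half {t : ℝ} {n : ℕ} (hn : 1 ≤ n) (ht : ((n : ℝ) ^ 2 + 4) * t ≤ 2 * (1 - Real.sqrt 2 / 2) ^ n) : t < 1 / 2 := by
  obtain ⟨hlo, hhi⟩ := one_sub_sqrt_two_div_two_bounds
  have hpow : (1 - Real.sqrt 2 / 2) ^ n ≤ (1 - Real.sqrt 2 / 2) ^ 1 := pow_le_pow_of_le_one (by linarith) (by linarith) hn
  rw [pow_one] at hpow
  have hn1 : (1 : ℝ) ≤ n := by exact_mod_cast hn
  nlinarith

/-- **THE NUMERICAL ASSEMBLY**: `c = √2∕2`, `θ = 1 − c(1 − 2t)`, `η ≥ 0`, `t ≥ 0`, `(n² + 4)·t ≤ 2·(1 − c)^n` ⟹ `η·(1 + n²t∕2)·(1 − θ^n) ≤ η·(1 − 2t)`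
(`θ ≥ 1 − c ≥ 0`, so `1 − θ^n ≤ 1 − (1−c)^n`; `(1 + x)(1 − y) ≤ 1 + x − y`; and `n²t∕2 + 2t ≤ (1−c)^n`). [folklore] -/
theorem assembly_le {t η : ℝ} {n : ℕ} (ht0 : 0 ≤ t) (hη : 0 ≤ η) (ht : ((n : ℝ) ^ 2 + 4) * t ≤ 2 * (1 - Real.sqrt 2 / 2) ^ n) :
    η * (1 + (n : ℝ) ^ 2 * t / 2) * (1 - (1 - Real.sqrt 2 / 2 * (1 - 2 * t)) ^ n) ≤ η * (1 - 2 * t) := by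
  obtain ⟨hlo, _⟩ := one_sub_sqrt_two_div_two_bounds
  set θ₀ : ℝ := 1 - Real.sqrt 2 / 2 with hθ₀_def
  set θ : ℝ := 1 - Real.sqrt 2 / 2 * (1 - 2 * t) with hθ_def
  have hθ₀0 : 0 ≤ θ₀ := by linarith
  have hθ₀θ : θ₀ ≤ θ := by
    simp only [hθ₀_def, hθ_def]; nlinarith [Real.sqrt_nonneg 2]
  have hpow : θ₀ ^ n ≤ θ ^ n := pow_le_pow_left₀ hθ₀0 hθ₀θ n
  have hpow0 : 0 ≤ θ₀ ^ n := pow_nonneg hθ₀0 n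
  have hx : 0 ≤ (n : ℝ) ^ 2 * t / 2 := by positivity
  -- (1 + x)(1 − θ^n) ≤ (1 + x)(1 − θ₀^n) ≤ 1 + x − θ₀^n ≤ 1 − 2t
  have h1 : (1 + (n : ℝ) ^ 2 * t / 2) * (1 - θ ^ n) ≤ (1 + (n : ℝ) ^ 2 * t / 2) * (1 - θ₀ ^ n) :=
    mul_le_mul_of_nonneg_left (by linarith) (by linarith)
  have h2 : (1 + (n : ℝ) ^ 2 * t / 2) * (1 - θ₀ ^ n) ≤ 1 + (n : ℝ) ^ 2 * t / 2 - θ₀ ^ n := by nlinarith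
  have h3 : 1 + (n : ℝ) ^ 2 * t / 2 - θ₀ ^ n ≤ 1 - 2 * t := by simp only [hθ₀_def]; linarith
  calc η * (1 + (n : ℝ) ^ 2 * t / 2) * (1 - θ ^ n) = η * ((1 + (n : ℝ) ^ 2 * t / 2) * (1 - θ ^ n)) := by ring
    _ ≤ η * (1 - 2 * t) := mul_le_mul_of_nonneg_left (h1.trans (h2.trans h3)) hη

end Summit.QuantumFields.BalabanUV.Beta.EriceRemainderEnclosureHistoryAutonomyComparisonTowerLemmas

end
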